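import Summits.CriticalPhenomena.PercolationContinuityZ3.Theorems.Transplant.FKConnectivityAllQPat3KNetT2
import Summits.CriticalPhenomena.PercolationContinuityZ3.Theorems.Transplant.FKConnectivityAllQPat3MinorSteps
import Summits.CriticalPhenomena.PercolationContinuityZ3.Theorems.Transplant.FKConnectivityAllQPat3CornerP11Leaf
import Summits.CriticalPhenomena.PercolationContinuityZ3.Theorems.Transplant.FKConnectivityAllQPat3ThetaRingP11Leaf
import HarnessLib

/-!
# Connectivity correlation inequalities for `φ_{w,q}`, every `q > 0` — THEOREM SP(𝒦): the packaged leaves of the minor recursion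

Helper file (`--supports stmt-CriticalPhenomena-4575`), census lineage (gen 41) of LANE 2's FK sub-programme; builds on p205010 (kernel
theorem, internal audit signed; external expert review pending).  No definitions, no named facts, no sorries; standard axioms.

Census g37's «Pat3MinorSteps» packages the leaves of THEOREM SP's minor recursion — `FK.spGoodC_inner / parTwo / corner / theta / ring` —
for two-terminal series–parallel pieces (`FK.IsTTSP`), the piece inequality being census g37's `FK.famT12C_nonneg`.  This file is the
same package ONE RUNG UP: the pieces are bridge–series–parallel networks (`FK.IsKNet`, census g41 «Pat3KNetDefs»), the piece inequality is
THEOREM 𝒯₂(𝒦) (`FK.famP11C_nonneg_of_isKNet`, «Pat3KNetT2») and the glued leaves are census g40's `famP11` leaf lemmas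
(«Pat3CornerP11Leaf», «Pat3ThetaRingP11Leaf» — hypothesis form `hval`, class-agnostic), whose missing orbit members (`STAR` with the apex in
another piece) are obtained by re-instantiating the symmetric leaf with the pieces permuted (`FK.lev2C_swap_xy / swap_ys`).
* `FK.famP11C_par_step`, `FK.spGoodC_parTwoK` — cut through two marks, three-mark side a 𝒦-network;
* `FK.spGoodC_cornerK`, `FK.spGoodC_thetaK`, `FK.spGoodC_ringK` — the CORNER / THETA / RING leaves with 𝒦-pieces.
(`FK.spGoodC_cutS / cut1 / oneSided` of «Pat3MinorSteps» are hypothesis-form already and are used as they are.)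
[cite: AyyerLinussonRavichandran2025, §7 (p. 22)]
-/

namespace Summit.CriticalPhenomena.PercolationContinuityZ3.Theorems

namespace FK

open SimpleGraph Literature.Probability.LatticeModels Literature.Probability.Percolation
open scoped Classical

variable {V : Type*}

section StepsK

variable [Fintype V]

omit [Fintype V] in
/-- Six pairwise distinct vertices are injective names `Fin 6 → V`. [folklore] -/
theorem injective_vec6 {a b c d s t : V} (hab : a ≠ b) (hac : a ≠ c) (had : a ≠ d) (has : a ≠ s) (hat : a ≠ t) (hbc : b ≠ c)
    (hbd : b ≠ d) (hbs : b ≠ s) (hbt : b ≠ t) (hcd : c ≠ d) (hcs : c ≠ s) (hct : c ≠ t) (hds : d ≠ s) (hdt : d ≠ t) (hst : s ≠ t) :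
    Function.Injective ![a, b, c, d, s, t] := by
  intro i j h
  fin_cases i <;> fin_cases j <;> simp at h <;>
    first | rfl | exact absurd h ‹_› | exact absurd h.symm ‹_›

omit [Fintype V] in
/-- The empty skeleton contributes no plain edges. [folklore] -/
theorem plainSet_nil' {ι : Type*} (p : ι → V) : plainSet p ([] : List (ι × ι)) = ∅ := by
  simp [plainSet]

/-- **STEP P2 on minors, 𝒦 form**: two-mark side any `(x, y)`-part `N₁`, three-mark side a bridge–series–parallel network `N₂`
with inner mark `s`; all eleven `famP11` members are nonnegative on the glued minor (census g39's `famP11_cert_par` + THEOREM 𝒯₂(𝒦)).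
[cite: AyyerLinussonRavichandran2025, §7 (p. 22)] -/
theorem famP11C_par_step {N₁ N₂ E₁ C₁ E₂ C₂ : Finset (Sym2 V)} {x y s : V} (hdN : Disjoint N₁ N₂)
    (hV : ∀ z : V, (∃ e ∈ N₁, z ∈ e) → (∃ e ∈ N₂, z ∈ e) → z = x ∨ z = y) (hxy : x ≠ y) (h₂ : IsKNet N₂ x y)
    (hE₁ : E₁ ⊆ N₁) (hC₁ : C₁ ⊆ N₁) (hE₂ : E₂ ⊆ N₂) (hC₂ : C₂ ⊆ N₂)
    (hs : ∃ e ∈ N₂, s ∈ e) (hsx : s ≠ x) (hsy : s ≠ y) (w : ℕ → ℝ) (hw : ∀ n, 0 ≤ w n) (i : ℕ) :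
    0 ≤ mval2C w (E₁ ∪ E₂) (C₁ ∪ C₂) x y s (famGet famP11 i) := by
  by_cases hi : famP11.length ≤ i
  · rw [famGet_of_le hi, mval2C_zero]
  have hi' : i < famP11.length := lt_of_not_ge hi
  have hS : {z : V | ∃ e ∈ N₁, z ∈ e} ∩ {z : V | ∃ e ∈ N₂, z ∈ e} ⊆ ({x, y} : Set V) := fun z hz => by
    rcases hV z hz.1 hz.2 with h | h <;> simp [h]
  have hsV : s ∉ {z : V | ∃ e ∈ N₁, z ∈ e} := fun h => by
    rcases hV s h hs with h' | h'
    · exact hsx h'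
    · exact hsy h'
  exact mval2C_par_nonneg hdN (spanE_mem N₁) (spanE_mem N₂) hE₁ hC₁ hE₂ hC₂ hS hxy hsV hsx hsy
    (G := fun a' a'' => famGet famP11 (selP11Par i a' a'').1) (m := fun a' a'' => (selP11Par i a' a'').2.1)
    (k := fun a' a'' => (selP11Par i a' a'').2.2) (fun a' a'' => (certGlueFam_spec famP11_cert_par hi' a' a'').1)
    (fun a' a'' => (certGlueFam_spec famP11_cert_par hi' a' a'').2)
    (fun a' a'' w' hw' => famP11C_nonneg_of_isKNet h₂ hE₂ hC₂ hs hsx hsy hw' _) w hw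

/-- **STEP P2 on minors (cut through two marks), 𝒦 form.** [cite: AyyerLinussonRavichandran2025, §7 (p. 22)] -/
theorem spGoodC_parTwoK {N₁ N₂ E₁ C₁ E₂ C₂ : Finset (Sym2 V)} {x y s : V} (hdN : Disjoint N₁ N₂)
    (hV : ∀ z : V, (∃ e ∈ N₁, z ∈ e) → (∃ e ∈ N₂, z ∈ e) → z = x ∨ z = y) (hxy : x ≠ y) (h₂ : IsKNet N₂ x y)
    (hE₁ : E₁ ⊆ N₁) (hC₁ : C₁ ⊆ N₁) (hE₂ : E₂ ⊆ N₂) (hC₂ : C₂ ⊆ N₂)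
    (hs : ∃ e ∈ N₂, s ∈ e) (hsx : s ≠ x) (hsy : s ≠ y) : SPGoodC (E₁ ∪ E₂) (C₁ ∪ C₂) x y s :=
  SPGoodC.of_mval2 (fun w hw => famP11C_par_step hdN hV hxy h₂ hE₁ hC₁ hE₂ hC₂ hs hsx hsy w hw 0)
    (fun w hw => famP11C_par_step hdN hV hxy h₂ hE₁ hC₁ hE₂ hC₂ hs hsx hsy w hw 1)
    (fun w hw => famP11C_par_step hdN hV hxy h₂ hE₁ hC₁ hE₂ hC₂ hs hsx hsy w hw 2)
    (fun w hw => famP11C_par_step hdN hV hxy h₂ hE₁ hC₁ hE₂ hC₂ hs hsx hsy w hw 3)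

/-- The CORNER leaf with 𝒦-pieces, three of the four targets (`T_sym`, `STAR` at the pole, `STAR` at the first inner mark) — the
`famP11` corner certificates of census g40 («Pat3CornerP11Leaf») fed with THEOREM 𝒯₂(𝒦). [cite: AyyerLinussonRavichandran2025, §7 (p. 22)] -/
theorem cornerK_three {N₁ N₂ E₁ C₁ E₂ C₂ : Finset (Sym2 V)} {u v s t : V} (hdN : Disjoint N₁ N₂)
    (hV : ∀ z : V, (∃ e ∈ N₁, z ∈ e) → (∃ e ∈ N₂, z ∈ e) → z = u ∨ z = v) (h₁ : IsKNet N₁ u v) (h₂ : IsKNet N₂ u v)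
    (hE₁ : E₁ ⊆ N₁) (hC₁ : C₁ ⊆ N₁) (hE₂ : E₂ ⊆ N₂) (hC₂ : C₂ ⊆ N₂)
    (hs : ∃ e ∈ N₁, s ∈ e) (ht : ∃ e ∈ N₂, t ∈ e) (hsu : s ≠ u) (hsv : s ≠ v) (htu : t ≠ u) (htv : t ≠ v) (μ : ℕ) :
    0 ≤ lev2C (E₁ ∪ E₂) (C₁ ∪ C₂) u s t tsym2Tab μ ∧ 0 ≤ lev2C (E₁ ∪ E₂) (C₁ ∪ C₂) u s t starXTab μ ∧
      0 ≤ lev2C (E₁ ∪ E₂) (C₁ ∪ C₂) u s t (mirror2 starXTab) μ := by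
  have hs2 : s ∉ {z : V | ∃ e ∈ N₂, z ∈ e} := fun h => by
    rcases hV s hs h with h' | h'
    · exact hsu h'
    · exact hsv h'
  have ht1 : t ∉ {z : V | ∃ e ∈ N₁, z ∈ e} := fun h => by
    rcases hV t h ht with h' | h'
    · exact htu h'
    · exact htv h'
  have hst : s ≠ t := fun h => ht1 (h ▸ hs)
  have huv : u ≠ v := h₁.ne
  set p : Fin 4 → V := ![u, v, s, t] with hp
  have hinj : Function.Injective p := injective_vec4 huv hsu.symm htu.symm hsv.symm htv.symm hst
  have gE1 := span_sub_of_subset (spanE_mem N₁) hE₁ hC₁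
  have gE2 := span_sub_of_subset (spanE_mem N₂) hE₂ hC₂
  have hp1 : ∀ a, p a ∈ {z : V | ∃ e ∈ N₁, z ∈ e} → p a = p 0 ∨ p a = p 1 ∨ p a = p 2 := by
    intro a ha
    fin_cases a
    · exact Or.inl rfl
    · exact Or.inr (Or.inl rfl)
    · exact Or.inr (Or.inr rfl)
    · exact absurd ha ht1
  have hp2 : ∀ a, p a ∈ {z : V | ∃ e ∈ N₂, z ∈ e} → p a = p 0 ∨ p a = p 1 ∨ p a = p 3 := by
    intro a ha
    fin_cases a
    · exact Or.inl rfl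
    · exact Or.inr (Or.inl rfl)
    · exact absurd ha hs2
    · exact Or.inr (Or.inr rfl)
  have h12 : ∀ z ∈ {z : V | ∃ e ∈ N₁, z ∈ e}, z ∈ {z : V | ∃ e ∈ N₂, z ∈ e} → z = p 0 ∨ z = p 1 := fun z h h' => hV z h h'
  have hPS : plainSet p cornerPSkel = ∅ := by rw [cornerPSkel]; exact plainSet_nil' p
  have hd1 : Disjoint (plainSet p cornerPSkel) E₁ := by rw [hPS]; exact Finset.disjoint_empty_left _
  have hd2 : Disjoint (plainSet p cornerPSkel ∪ E₁) E₂ := by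
    rw [hPS, Finset.empty_union]; exact Finset.disjoint_of_subset_left hE₁ (Finset.disjoint_of_subset_right hE₂ hdN)
  have hval1 : ∀ i ν, 0 ≤ lev2C E₁ C₁ (p 0) (p 1) (p 2) (famGet famP11 i) ν := fun i ν =>
    famP11C_level_nonneg_of_isKNet h₁ hE₁ hC₁ hs hsu hsv i ν
  have hval2 : ∀ i ν, 0 ≤ lev2C E₂ C₂ (p 0) (p 1) (p 3) (famGet famP11 i) ν := fun i ν =>
    famP11C_level_nonneg_of_isKNet h₂ hE₂ hC₂ ht htu htv i ν
  have eE : plainSet p cornerPSkel ∪ E₁ ∪ E₂ = E₁ ∪ E₂ := by rw [hPS, Finset.empty_union]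
  have hT := cornerP11_tsym_level_nonneg hinj gE1 gE2 hp1 hp2 h12 hs ht hd1 hd2 hval1 hval2 μ
  have hX := cornerP11_starX_level_nonneg hinj gE1 gE2 hp1 hp2 h12 hs ht hd1 hd2 hval1 hval2 μ
  have hM := cornerP11_starXm_level_nonneg hinj gE1 gE2 hp1 hp2 h12 hs ht hd1 hd2 hval1 hval2 μ
  rw [eE] at hT hX hM
  exact ⟨hT, hX, hM⟩

/-- **STEP CORNER on minors, 𝒦 form** (the fourth target, `STAR` at the second inner mark, is the third target of the same leaf with
the two pieces exchanged, `FK.lev2C_swap_ys`). [cite: AyyerLinussonRavichandran2025, §7 (p. 22)] -/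
theorem spGoodC_cornerK {N₁ N₂ E₁ C₁ E₂ C₂ : Finset (Sym2 V)} {u v s t : V} (hdN : Disjoint N₁ N₂)
    (hV : ∀ z : V, (∃ e ∈ N₁, z ∈ e) → (∃ e ∈ N₂, z ∈ e) → z = u ∨ z = v) (h₁ : IsKNet N₁ u v) (h₂ : IsKNet N₂ u v)
    (hE₁ : E₁ ⊆ N₁) (hC₁ : C₁ ⊆ N₁) (hE₂ : E₂ ⊆ N₂) (hC₂ : C₂ ⊆ N₂)
    (hs : ∃ e ∈ N₁, s ∈ e) (ht : ∃ e ∈ N₂, t ∈ e) (hsu : s ≠ u) (hsv : s ≠ v) (htu : t ≠ u) (htv : t ≠ v) :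
    SPGoodC (E₁ ∪ E₂) (C₁ ∪ C₂) u s t := by
  intro μ
  obtain ⟨hT, hX, hM⟩ := cornerK_three hdN hV h₁ h₂ hE₁ hC₁ hE₂ hC₂ hs ht hsu hsv htu htv μ
  have hV' : ∀ z : V, (∃ e ∈ N₂, z ∈ e) → (∃ e ∈ N₁, z ∈ e) → z = u ∨ z = v := fun z h h' => hV z h' h
  obtain ⟨-, -, hM'⟩ := cornerK_three hdN.symm hV' h₂ h₁ hE₂ hC₂ hE₁ hC₁ ht hs htu htv hsu hsv μ
  refine ⟨hT, hX, hM, ?_⟩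
  rw [← mirror23_mirror2_starXTab, ← lev2C_swap_ys, Finset.union_comm E₁, Finset.union_comm C₁]
  exact hM'

/-- The THETA leaf with 𝒦-pieces, two of the four targets (`T_sym` and `STAR` with apex the mark of the FIRST piece) — census g40's
«Pat3ThetaRingP11Leaf» fed with THEOREM 𝒯₂(𝒦). [cite: AyyerLinussonRavichandran2025, §7 (p. 22)] -/
theorem thetaK_two {NK N₁ N₂ EK CK E₁ C₁ E₂ C₂ : Finset (Sym2 V)} {u v b s t : V} (hdK1 : Disjoint NK N₁)
    (hdK2 : Disjoint NK N₂) (hd12 : Disjoint N₁ N₂)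
    (hVK1 : ∀ z : V, (∃ e ∈ NK, z ∈ e) → (∃ e ∈ N₁, z ∈ e) → z = u ∨ z = v)
    (hVK2 : ∀ z : V, (∃ e ∈ NK, z ∈ e) → (∃ e ∈ N₂, z ∈ e) → z = u ∨ z = v)
    (hV12 : ∀ z : V, (∃ e ∈ N₁, z ∈ e) → (∃ e ∈ N₂, z ∈ e) → z = u ∨ z = v)
    (hK : IsKNet NK u v) (h₁ : IsKNet N₁ u v) (h₂ : IsKNet N₂ u v)
    (hEK : EK ⊆ NK) (hCK : CK ⊆ NK) (hE₁ : E₁ ⊆ N₁) (hC₁ : C₁ ⊆ N₁) (hE₂ : E₂ ⊆ N₂) (hC₂ : C₂ ⊆ N₂)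
    (hb : ∃ e ∈ NK, b ∈ e) (hs : ∃ e ∈ N₁, s ∈ e) (ht : ∃ e ∈ N₂, t ∈ e)
    (hbu : b ≠ u) (hbv : b ≠ v) (hsu : s ≠ u) (hsv : s ≠ v) (htu : t ≠ u) (htv : t ≠ v) (μ : ℕ) :
    0 ≤ lev2C (EK ∪ E₁ ∪ E₂) (CK ∪ C₁ ∪ C₂) b s t tsym2Tab μ ∧ 0 ≤ lev2C (EK ∪ E₁ ∪ E₂) (CK ∪ C₁ ∪ C₂) b s t starXTab μ := by
  have off : ∀ {A B : Finset (Sym2 V)} {q : V}, (∀ z : V, (∃ e ∈ A, z ∈ e) → (∃ e ∈ B, z ∈ e) → z = u ∨ z = v) →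
      (∃ e ∈ A, q ∈ e) → q ≠ u → q ≠ v → q ∉ {z : V | ∃ e ∈ B, z ∈ e} := fun h hq hqu hqv hqB => by
    rcases h _ hq hqB with h' | h'
    · exact hqu h'
    · exact hqv h'
  have off' : ∀ {A B : Finset (Sym2 V)} {q : V}, (∀ z : V, (∃ e ∈ A, z ∈ e) → (∃ e ∈ B, z ∈ e) → z = u ∨ z = v) →
      (∃ e ∈ B, q ∈ e) → q ≠ u → q ≠ v → q ∉ {z : V | ∃ e ∈ A, z ∈ e} := fun h hq hqu hqv hqA => by
    rcases h _ hqA hq with h' | h'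
    · exact hqu h'
    · exact hqv h'
  have hb1 := off hVK1 hb hbu hbv
  have hb2 := off hVK2 hb hbu hbv
  have hsK := off' hVK1 hs hsu hsv
  have hs2 := off hV12 hs hsu hsv
  have htK := off' hVK2 ht htu htv
  have ht1 := off' hV12 ht htu htv
  have hbs : b ≠ s := fun h => hb1 (h ▸ hs)
  have hbt : b ≠ t := fun h => hb2 (h ▸ ht)
  have hst : s ≠ t := fun h => hs2 (h ▸ ht)
  have huv : u ≠ v := hK.ne
  set p : Fin 5 → V := ![u, v, b, s, t] with hp
  have hinj : Function.Injective p := injective_vec5 huv hbu.symm hsu.symm hbv.symm hsv.symm hbs htu htv hbt.symm hst.symm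
  have gEK := span_sub_of_subset (spanE_mem NK) hEK hCK
  have gE1 := span_sub_of_subset (spanE_mem N₁) hE₁ hC₁
  have gE2 := span_sub_of_subset (spanE_mem N₂) hE₂ hC₂
  have hpK : ∀ a, p a ∈ {z : V | ∃ e ∈ NK, z ∈ e} → p a = p 0 ∨ p a = p 1 ∨ p a = p 2 := by
    intro a ha
    fin_cases a
    · exact Or.inl rfl
    · exact Or.inr (Or.inl rfl)
    · exact Or.inr (Or.inr rfl)
    · exact absurd ha hsK
    · exact absurd ha htK
  have hp1 : ∀ a, p a ∈ {z : V | ∃ e ∈ N₁, z ∈ e} → p a = p 0 ∨ p a = p 1 ∨ p a = p 3 := by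
    intro a ha
    fin_cases a
    · exact Or.inl rfl
    · exact Or.inr (Or.inl rfl)
    · exact absurd ha hb1
    · exact Or.inr (Or.inr rfl)
    · exact absurd ha ht1
  have hp2 : ∀ a, p a ∈ {z : V | ∃ e ∈ N₂, z ∈ e} → p a = p 0 ∨ p a = p 1 ∨ p a = p 4 := by
    intro a ha
    fin_cases a
    · exact Or.inl rfl
    · exact Or.inr (Or.inl rfl)
    · exact absurd ha hb2
    · exact absurd ha hs2
    · exact Or.inr (Or.inr rfl)
  have hPS : plainSet p thetaPSkel = ∅ := by rw [thetaPSkel]; exact plainSet_nil' p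
  have hdK : Disjoint (plainSet p thetaPSkel) EK := by rw [hPS]; exact Finset.disjoint_empty_left _
  have hd1 : Disjoint (plainSet p thetaPSkel ∪ EK) E₁ := by
    rw [hPS, Finset.empty_union]; exact Finset.disjoint_of_subset_left hEK (Finset.disjoint_of_subset_right hE₁ hdK1)
  have hd2 : Disjoint (plainSet p thetaPSkel ∪ EK ∪ E₁) E₂ := by
    rw [hPS, Finset.empty_union, Finset.disjoint_union_left]
    exact ⟨Finset.disjoint_of_subset_left hEK (Finset.disjoint_of_subset_right hE₂ hdK2),
      Finset.disjoint_of_subset_left hE₁ (Finset.disjoint_of_subset_right hE₂ hd12)⟩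
  have hvalK : ∀ i ν, 0 ≤ lev2C EK CK (p 0) (p 1) (p 2) (famGet famP11 i) ν := fun i ν =>
    famP11C_level_nonneg_of_isKNet hK hEK hCK hb hbu hbv i ν
  have hval1 : ∀ i ν, 0 ≤ lev2C E₁ C₁ (p 0) (p 1) (p 3) (famGet famP11 i) ν := fun i ν =>
    famP11C_level_nonneg_of_isKNet h₁ hE₁ hC₁ hs hsu hsv i ν
  have hval2 : ∀ i ν, 0 ≤ lev2C E₂ C₂ (p 0) (p 1) (p 4) (famGet famP11 i) ν := fun i ν =>
    famP11C_level_nonneg_of_isKNet h₂ hE₂ hC₂ ht htu htv i ν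
  have eE : plainSet p thetaPSkel ∪ EK ∪ E₁ ∪ E₂ = EK ∪ E₁ ∪ E₂ := by rw [hPS, Finset.empty_union]
  have hT := thetaP11_tsym_level_nonneg hinj gEK gE1 gE2 hpK hp1 hp2 (fun z h h' => hVK1 z h h') (fun z h h' => hVK2 z h h')
    (fun z h h' => hV12 z h h') hb hs ht hdK hd1 hd2 hvalK hval1 hval2 μ
  have hX := thetaP11_starX_level_nonneg hinj gEK gE1 gE2 hpK hp1 hp2 (fun z h h' => hVK1 z h h') (fun z h h' => hVK2 z h h')
    (fun z h h' => hV12 z h h') hb hs ht hdK hd1 hd2 hvalK hval1 hval2 μ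
  rw [eE] at hT hX
  exact ⟨hT, hX⟩

/-- **STEP THETA on minors, 𝒦 form**: the four targets at `(b, s, t)` from three instances of the symmetric THETA leaf (pieces permuted
so that the `STAR` apex lies in the first piece; `FK.lev2C_swap_xy / swap_ys`). [cite: AyyerLinussonRavichandran2025, §7 (p. 22)] -/
theorem spGoodC_thetaK {NK N₁ N₂ EK CK E₁ C₁ E₂ C₂ : Finset (Sym2 V)} {u v b s t : V} (hdK1 : Disjoint NK N₁)
    (hdK2 : Disjoint NK N₂) (hd12 : Disjoint N₁ N₂)
    (hVK1 : ∀ z : V, (∃ e ∈ NK, z ∈ e) → (∃ e ∈ N₁, z ∈ e) → z = u ∨ z = v)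
    (hVK2 : ∀ z : V, (∃ e ∈ NK, z ∈ e) → (∃ e ∈ N₂, z ∈ e) → z = u ∨ z = v)
    (hV12 : ∀ z : V, (∃ e ∈ N₁, z ∈ e) → (∃ e ∈ N₂, z ∈ e) → z = u ∨ z = v)
    (hK : IsKNet NK u v) (h₁ : IsKNet N₁ u v) (h₂ : IsKNet N₂ u v)
    (hEK : EK ⊆ NK) (hCK : CK ⊆ NK) (hE₁ : E₁ ⊆ N₁) (hC₁ : C₁ ⊆ N₁) (hE₂ : E₂ ⊆ N₂) (hC₂ : C₂ ⊆ N₂)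
    (hb : ∃ e ∈ NK, b ∈ e) (hs : ∃ e ∈ N₁, s ∈ e) (ht : ∃ e ∈ N₂, t ∈ e)
    (hbu : b ≠ u) (hbv : b ≠ v) (hsu : s ≠ u) (hsv : s ≠ v) (htu : t ≠ u) (htv : t ≠ v) :
    SPGoodC (EK ∪ E₁ ∪ E₂) (CK ∪ C₁ ∪ C₂) b s t := by
  intro μ
  have sy : ∀ {A B : Finset (Sym2 V)}, (∀ z : V, (∃ e ∈ A, z ∈ e) → (∃ e ∈ B, z ∈ e) → z = u ∨ z = v) →
      ∀ z : V, (∃ e ∈ B, z ∈ e) → (∃ e ∈ A, z ∈ e) → z = u ∨ z = v := fun h z h' h'' => h z h'' h'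
  obtain ⟨hT, hX⟩ := thetaK_two hdK1 hdK2 hd12 hVK1 hVK2 hV12 hK h₁ h₂ hEK hCK hE₁ hC₁ hE₂ hC₂ hb hs ht hbu hbv hsu hsv htu htv μ
  -- apex `s`: pieces (N₁, NK, N₂), marks (s, b, t)
  obtain ⟨-, hXs⟩ := thetaK_two hdK1.symm hd12 hdK2 (sy hVK1) hV12 hVK2 h₁ hK h₂ hE₁ hC₁ hEK hCK hE₂ hC₂ hs hb ht hsu hsv hbu hbv
    htu htv μ
  -- apex `t`: pieces (N₂, NK, N₁), marks (t, b, s)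
  obtain ⟨-, hXt⟩ := thetaK_two hdK2.symm hd12.symm hdK1 (sy hVK2) (sy hV12) hVK1 h₂ hK h₁ hE₂ hC₂ hEK hCK hE₁ hC₁ ht hb hs htu htv
    hbu hbv hsu hsv μ
  refine ⟨hT, hX, ?_, ?_⟩
  · rw [← lev2C_swap_xy]
    rw [show E₁ ∪ EK ∪ E₂ = EK ∪ E₁ ∪ E₂ by ac_rfl, show C₁ ∪ CK ∪ C₂ = CK ∪ C₁ ∪ C₂ by ac_rfl] at hXs
    exact hXs
  · rw [← mirror23_mirror2_starXTab, ← lev2C_swap_ys, ← lev2C_swap_xy]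
    rw [show E₂ ∪ EK ∪ E₁ = EK ∪ E₁ ∪ E₂ by ac_rfl, show C₂ ∪ CK ∪ C₁ = CK ∪ C₁ ∪ C₂ by ac_rfl] at hXt
    exact hXt

/-- The RING leaf with 𝒦-pieces, two of the four targets (`T_sym` and `STAR` with apex the mark of the piece `NK` opposite the
junction `w`) — census g40's «Pat3ThetaRingP11Leaf» fed with THEOREM 𝒯₂(𝒦).  Pieces: `NK` between `v, u` (mark `b`), `N₁` between
`u, w` (mark `s`), `N₂` between `w, v` (mark `t`). [cite: AyyerLinussonRavichandran2025, §7 (p. 22)] -/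
theorem ringK_two {NK N₁ N₂ EK CK E₁ C₁ E₂ C₂ : Finset (Sym2 V)} {u v w b s t : V} (hdK1 : Disjoint NK N₁)
    (hdK2 : Disjoint NK N₂) (hd12 : Disjoint N₁ N₂) (hVK1 : ∀ z : V, (∃ e ∈ NK, z ∈ e) → (∃ e ∈ N₁, z ∈ e) → z = u)
    (hV12 : ∀ z : V, (∃ e ∈ N₁, z ∈ e) → (∃ e ∈ N₂, z ∈ e) → z = w)
    (hVK2 : ∀ z : V, (∃ e ∈ NK, z ∈ e) → (∃ e ∈ N₂, z ∈ e) → z = v)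
    (hu2 : ¬ ∃ e ∈ N₂, u ∈ e) (hv1 : ¬ ∃ e ∈ N₁, v ∈ e) (huw : u ≠ w) (hvw : v ≠ w)
    (hK : IsKNet NK v u) (h₁ : IsKNet N₁ u w) (h₂ : IsKNet N₂ w v)
    (hEK : EK ⊆ NK) (hCK : CK ⊆ NK) (hE₁ : E₁ ⊆ N₁) (hC₁ : C₁ ⊆ N₁) (hE₂ : E₂ ⊆ N₂) (hC₂ : C₂ ⊆ N₂)
    (hb : ∃ e ∈ NK, b ∈ e) (hs : ∃ e ∈ N₁, s ∈ e) (ht : ∃ e ∈ N₂, t ∈ e)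
    (hbu : b ≠ u) (hbv : b ≠ v) (hsu : s ≠ u) (hsw : s ≠ w) (htv : t ≠ v) (htw : t ≠ w) (μ : ℕ) :
    0 ≤ lev2C (EK ∪ E₁ ∪ E₂) (CK ∪ C₁ ∪ C₂) b s t tsym2Tab μ ∧ 0 ≤ lev2C (EK ∪ E₁ ∪ E₂) (CK ∪ C₁ ∪ C₂) b s t starXTab μ := by
  have huv : u ≠ v := hK.ne.symm
  have hwK : w ∉ {z : V | ∃ e ∈ NK, z ∈ e} := fun h => huw.symm (hVK1 w h h₁.right_mem)
  have hb1 : b ∉ {z : V | ∃ e ∈ N₁, z ∈ e} := fun h => hbu (hVK1 b hb h)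
  have hb2 : b ∉ {z : V | ∃ e ∈ N₂, z ∈ e} := fun h => hbv (hVK2 b hb h)
  have hsK : s ∉ {z : V | ∃ e ∈ NK, z ∈ e} := fun h => hsu (hVK1 s h hs)
  have hs2 : s ∉ {z : V | ∃ e ∈ N₂, z ∈ e} := fun h => hsw (hV12 s hs h)
  have htK : t ∉ {z : V | ∃ e ∈ NK, z ∈ e} := fun h => htv (hVK2 t h ht)
  have ht1 : t ∉ {z : V | ∃ e ∈ N₁, z ∈ e} := fun h => htw (hV12 t h ht)
  have hu2' : u ∉ {z : V | ∃ e ∈ N₂, z ∈ e} := hu2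
  have hv1' : v ∉ {z : V | ∃ e ∈ N₁, z ∈ e} := hv1
  have hsv : s ≠ v := fun h => hv1 (h ▸ hs)
  have htu : t ≠ u := fun h => hu2 (h ▸ ht)
  have hbs : b ≠ s := fun h => hb1 (h ▸ hs)
  have hbt : b ≠ t := fun h => hb2 (h ▸ ht)
  have hst : s ≠ t := fun h => hs2 (h ▸ ht)
  have hbw : b ≠ w := fun h => hwK (h ▸ hb)
  set p : Fin 6 → V := ![u, v, w, b, s, t] with hp
  have hinj : Function.Injective p :=
    injective_vec6 huv huw hbu.symm hsu.symm htu.symm hvw hbv.symm hsv.symm htv.symm hbw.symm hsw.symm htw.symm hbs hbt hst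
  have gEK := span_sub_of_subset (spanE_mem NK) hEK hCK
  have gE1 := span_sub_of_subset (spanE_mem N₁) hE₁ hC₁
  have gE2 := span_sub_of_subset (spanE_mem N₂) hE₂ hC₂
  have hpK : ∀ a, p a ∈ {z : V | ∃ e ∈ NK, z ∈ e} → p a = p 1 ∨ p a = p 0 ∨ p a = p 3 := by
    intro a ha
    fin_cases a
    · exact Or.inr (Or.inl rfl)
    · exact Or.inl rfl
    · exact absurd ha hwK
    · exact Or.inr (Or.inr rfl)
    · exact absurd ha hsK
    · exact absurd ha htK
  have hp1 : ∀ a, p a ∈ {z : V | ∃ e ∈ N₁, z ∈ e} → p a = p 0 ∨ p a = p 2 ∨ p a = p 4 := by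
    intro a ha
    fin_cases a
    · exact Or.inl rfl
    · exact absurd ha hv1'
    · exact Or.inr (Or.inl rfl)
    · exact absurd ha hb1
    · exact Or.inr (Or.inr rfl)
    · exact absurd ha ht1
  have hp2 : ∀ a, p a ∈ {z : V | ∃ e ∈ N₂, z ∈ e} → p a = p 2 ∨ p a = p 1 ∨ p a = p 5 := by
    intro a ha
    fin_cases a
    · exact absurd ha hu2'
    · exact Or.inr (Or.inl rfl)
    · exact Or.inl rfl
    · exact absurd ha hb2
    · exact absurd ha hs2
    · exact Or.inr (Or.inr rfl)
  have hK1 : ∀ z ∈ {z : V | ∃ e ∈ NK, z ∈ e}, z ∈ {z : V | ∃ e ∈ N₁, z ∈ e} → z = p 0 ∨ z = p 2 :=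
    fun z h h' => Or.inl (hVK1 z h h')
  have hK2 : ∀ z ∈ {z : V | ∃ e ∈ NK, z ∈ e}, z ∈ {z : V | ∃ e ∈ N₂, z ∈ e} → z = p 2 ∨ z = p 1 :=
    fun z h h' => Or.inr (hVK2 z h h')
  have h12 : ∀ z ∈ {z : V | ∃ e ∈ N₁, z ∈ e}, z ∈ {z : V | ∃ e ∈ N₂, z ∈ e} → z = p 2 ∨ z = p 1 :=
    fun z h h' => Or.inl (hV12 z h h')
  have hPS : plainSet p ringPSkel = ∅ := by rw [ringPSkel]; exact plainSet_nil' p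
  have hdK : Disjoint (plainSet p ringPSkel) EK := by rw [hPS]; exact Finset.disjoint_empty_left _
  have hd1 : Disjoint (plainSet p ringPSkel ∪ EK) E₁ := by
    rw [hPS, Finset.empty_union]; exact Finset.disjoint_of_subset_left hEK (Finset.disjoint_of_subset_right hE₁ hdK1)
  have hd2 : Disjoint (plainSet p ringPSkel ∪ EK ∪ E₁) E₂ := by
    rw [hPS, Finset.empty_union, Finset.disjoint_union_left]
    exact ⟨Finset.disjoint_of_subset_left hEK (Finset.disjoint_of_subset_right hE₂ hdK2),
      Finset.disjoint_of_subset_left hE₁ (Finset.disjoint_of_subset_right hE₂ hd12)⟩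
  have hvalK : ∀ i ν, 0 ≤ lev2C EK CK (p 1) (p 0) (p 3) (famGet famP11 i) ν := fun i ν =>
    famP11C_level_nonneg_of_isKNet hK hEK hCK hb hbv hbu i ν
  have hval1 : ∀ i ν, 0 ≤ lev2C E₁ C₁ (p 0) (p 2) (p 4) (famGet famP11 i) ν := fun i ν =>
    famP11C_level_nonneg_of_isKNet h₁ hE₁ hC₁ hs hsu hsw i ν
  have hval2 : ∀ i ν, 0 ≤ lev2C E₂ C₂ (p 2) (p 1) (p 5) (famGet famP11 i) ν := fun i ν =>
    famP11C_level_nonneg_of_isKNet h₂ hE₂ hC₂ ht htw htv i ν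
  have eE : plainSet p ringPSkel ∪ EK ∪ E₁ ∪ E₂ = EK ∪ E₁ ∪ E₂ := by rw [hPS, Finset.empty_union]
  have hT := ringP11_tsym_level_nonneg hinj gEK gE1 gE2 hpK hp1 hp2 hK1 hK2 h12 hb hs ht hdK hd1 hd2 hvalK hval1 hval2 μ
  have hX := ringP11_starX_level_nonneg hinj gEK gE1 gE2 hpK hp1 hp2 hK1 hK2 h12 hb hs ht hdK hd1 hd2 hvalK hval1 hval2 μ
  rw [eE] at hT hX
  exact ⟨hT, hX⟩

/-- **STEP RING on minors, 𝒦 form**: the four targets at `(b, s, t)` from three instances of the RING leaf — the ring rotated so that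
the `STAR` apex lies in the piece opposite the junction (`FK.lev2C_swap_xy / swap_ys`). [cite: AyyerLinussonRavichandran2025, §7 (p. 22)] -/
theorem spGoodC_ringK {NK N₁ N₂ EK CK E₁ C₁ E₂ C₂ : Finset (Sym2 V)} {u v w b s t : V} (hdK1 : Disjoint NK N₁)
    (hdK2 : Disjoint NK N₂) (hd12 : Disjoint N₁ N₂) (hVK1 : ∀ z : V, (∃ e ∈ NK, z ∈ e) → (∃ e ∈ N₁, z ∈ e) → z = u)
    (hV12 : ∀ z : V, (∃ e ∈ N₁, z ∈ e) → (∃ e ∈ N₂, z ∈ e) → z = w)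
    (hVK2 : ∀ z : V, (∃ e ∈ NK, z ∈ e) → (∃ e ∈ N₂, z ∈ e) → z = v)
    (hu2 : ¬ ∃ e ∈ N₂, u ∈ e) (hv1 : ¬ ∃ e ∈ N₁, v ∈ e) (huw : u ≠ w) (hvw : v ≠ w)
    (hK : IsKNet NK v u) (h₁ : IsKNet N₁ u w) (h₂ : IsKNet N₂ w v)
    (hEK : EK ⊆ NK) (hCK : CK ⊆ NK) (hE₁ : E₁ ⊆ N₁) (hC₁ : C₁ ⊆ N₁) (hE₂ : E₂ ⊆ N₂) (hC₂ : C₂ ⊆ N₂)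
    (hb : ∃ e ∈ NK, b ∈ e) (hs : ∃ e ∈ N₁, s ∈ e) (ht : ∃ e ∈ N₂, t ∈ e)
    (hbu : b ≠ u) (hbv : b ≠ v) (hsu : s ≠ u) (hsw : s ≠ w) (htv : t ≠ v) (htw : t ≠ w) :
    SPGoodC (EK ∪ E₁ ∪ E₂) (CK ∪ C₁ ∪ C₂) b s t := by
  intro μ
  have huv : u ≠ v := hK.ne.symm
  have hwK : ¬ ∃ e ∈ NK, w ∈ e := fun h => huw.symm (hVK1 w h h₁.right_mem)
  obtain ⟨hT, hX⟩ := ringK_two hdK1 hdK2 hd12 hVK1 hV12 hVK2 hu2 hv1 huw hvw hK h₁ h₂ hEK hCK hE₁ hC₁ hE₂ hC₂ hb hs ht hbu hbv hsu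
    hsw htv htw μ
  -- apex `s`: the ring rotated, pieces (N₁, N₂, NK), terminals (u', v', w') = (w, u, v), marks (s, t, b)
  obtain ⟨-, hXs⟩ := ringK_two hd12 hdK1.symm hdK2.symm hV12 (fun z h h' => hVK2 z h' h) (fun z h h' => hVK1 z h' h) hwK hu2
    hvw.symm huv h₁ h₂ hK hE₁ hC₁ hE₂ hC₂ hEK hCK hs ht hb hsw hsu htw htv hbu hbv μ
  -- apex `t`: the ring rotated the other way, pieces (N₂, NK, N₁), terminals (v, w, u), marks (t, b, s)
  obtain ⟨-, hXt⟩ := ringK_two hdK2.symm hd12.symm hdK1 (fun z h h' => hVK2 z h' h) hVK1 (fun z h h' => hV12 z h' h) hv1 hwK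
    huv.symm huw.symm h₂ hK h₁ hE₂ hC₂ hEK hCK hE₁ hC₁ ht hb hs htv htw hbv hbu hsw hsu μ
  refine ⟨hT, hX, ?_, ?_⟩
  · rw [← lev2C_swap_xy, ← mirror23_starXTab, ← lev2C_swap_ys]
    rw [show E₁ ∪ E₂ ∪ EK = EK ∪ E₁ ∪ E₂ by ac_rfl, show C₁ ∪ C₂ ∪ CK = CK ∪ C₁ ∪ C₂ by ac_rfl] at hXs
    exact hXs
  · rw [← mirror23_mirror2_starXTab, ← lev2C_swap_ys, ← lev2C_swap_xy]
    rw [show E₂ ∪ EK ∪ E₁ = EK ∪ E₁ ∪ E₂ by ac_rfl, show C₂ ∪ CK ∪ C₁ = CK ∪ C₁ ∪ C₂ by ac_rfl] at hXt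
    exact hXt

end StepsK

end FK

end Summit.CriticalPhenomena.PercolationContinuityZ3.Theorems
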